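import Summits.ABC.ABC.Theses.PadicPrincipalCoreRadFiveHalves
import Summits.ABC.StewartYu.PadicLogFormsPrincipalReductionSharp
import Summits.ABC.StewartYu.PadicCW77EpsShapeFiveHalves
import Summits.ABC.StewartYu.KappaDoorEpsShape
import Summits.ABC.ABC.Theorems.PadicPrincipalCoreST86TheoremA
import HarnessLib

/-!
# Route PadicPrincipalCoreRadFiveHalves (rung F-A1.M1⁺(5/2)): all five items closed by landed theorems

`Summits/ABC/ABC/Theorems/PadicPrincipalCoreRadFiveHalvesClosers.lean` — cell `abc-stewartyu`
(planner-staged WANTED file; any prover files it). Every item of the route is the text of a theorem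
already in the tree:

* `WPMFlat` (crux, p1's sharp principal generators, heights ≤ (n+1)!·(p−1)·log q, no n^n):
  `Summit.ABC.StewartYu.PrincipalLattice.exists_principal_generators_sharp`;
* `TheoremAOne` (crux, Theorem A with c₂ ≤ 1): `Summit.ABC.StewartYu.theoremAShapeLe_one_holds`;
* `GlueSpecFlat` (support, κ = c₂ + 3/2 from the flat generators): `Summit.ABC.StewartYu.glueSpecFlat_holds`;
* `OddKappaDoorSpec` (support, the odd κ-door): `Summit.ABC.StewartYu.KappaDoor.epsShapeBound_of_oddFinBound`;
* `Assembly`: the route's own `closes`.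
-/

set_option linter.dupNamespace false

namespace Summit.ABC.ABC.Theorems

/-- **Item `WPMFlat` of route PadicPrincipalCoreRadFiveHalves** (p1's sharp principal generators). [folklore] -/
theorem padicPrincipalCoreRadFiveHalves_wpmFlat_proof :
    Summit.ABC.ABC.Theses.PadicPrincipalCoreRadFiveHalves.WPMFlat :=
  Summit.ABC.StewartYu.PrincipalLattice.exists_principal_generators_sharp

/-- **Item `TheoremAOne` of route PadicPrincipalCoreRadFiveHalves** (Theorem A, `c₂ = 1`). [folklore] -/
theorem padicPrincipalCoreRadFiveHalves_theoremAOne_proof :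
    Summit.ABC.ABC.Theses.PadicPrincipalCoreRadFiveHalves.TheoremAOne :=
  Summit.ABC.StewartYu.theoremAShapeLe_one_holds

/-- **Item `GlueSpecFlat` of route PadicPrincipalCoreRadFiveHalves** (`κ = c₂ + 3/2`). [folklore] -/
theorem padicPrincipalCoreRadFiveHalves_glueSpecFlat_proof :
    Summit.ABC.ABC.Theses.PadicPrincipalCoreRadFiveHalves.GlueSpecFlat :=
  Summit.ABC.StewartYu.glueSpecFlat_holds

/-- **Item `OddKappaDoorSpec` of route PadicPrincipalCoreRadFiveHalves** (the odd κ-door). [folklore] -/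
theorem padicPrincipalCoreRadFiveHalves_oddKappaDoorSpec_proof :
    Summit.ABC.ABC.Theses.PadicPrincipalCoreRadFiveHalves.OddKappaDoorSpec := by
  unfold Summit.ABC.ABC.Theses.PadicPrincipalCoreRadFiveHalves.OddKappaDoorSpec
  intro K L κ σ τ τ₁ hK hL _hκ0 hσ0 hσ h
  exact Summit.ABC.StewartYu.KappaDoor.epsShapeBound_of_oddFinBound hK hL hσ0 hσ
    (fun p hp hp2 => h p hp hp2)

/-- **Item `Assembly` of route PadicPrincipalCoreRadFiveHalves**: the route's own `closes`. [folklore] -/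
theorem padicPrincipalCoreRadFiveHalves_assembly_proof :
    Summit.ABC.ABC.Theses.PadicPrincipalCoreRadFiveHalves.Assembly :=
  fun hA hM hG hO => Summit.ABC.ABC.Theses.PadicPrincipalCoreRadFiveHalves.closes hA hM hG hO

end Summit.ABC.ABC.Theorems
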